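import Literature.AlgebraicGeometry.Resolution.LogBlowupChart
import HarnessLib

/-!
# Crux `FrobeniusLadder.FRationalResolution` (stmt-ResolutionOfSingularities-15317), line `redirect`,
# stub `stub_diagonalizableQuotientResolution` — **the blow-up charts are chart algebras, and chart
# algebras compose** (point-blow-up recursion for the surface case over arbitrary fields, memo
# MEMO-15317-leafhand2-g6 §3–§4: the glue that lets the fixed-point / orthant-point theorems of
# `…ChartAlgebraNormalForm`, `…ChartAlgebraFixedPoint`, `…ChartAlgebraOrthantPoints` be ITERATED while
# staying over the one log regular base chart)

A **chart algebra** over a chart `φ : P → A` (`P ⊆ ℤⁿ`) is an `A`-algebra `C` with a monoid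
homomorphism `χ : Q → C`, `P ≤ Q ⊆ ℤⁿ`, such that: (χ) `χ|_P = φ`; (gen) `C = A[χ(Q)]`;
(D) every `q ∈ Q` has `q + p ∈ P` for some `p ∈ P`; (K) `a ↦ 0` in `C` only if `φ(p)a = 0` for some
`p ∈ P`; (Ω) every ring map `A → L` to a field with `φ(P) ∌ 0` extends to `C`. This file proves:

* the charts of a log blow-up are chart algebras: for `s ⊆ P`, `a ∈ s`... in fact for ANY `a ∈ P`,
  the affine blowup algebra `C = A[I/φ(a)]`, `I = (φ(s))`, with the tree's chart
  `χ = LogChart.blowupChart P φ s a : P_a → C` (`LogBlowupChart.lean`; (χ) and (gen) are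
  `LogChart.blowupChart_of_mem`, `LogChart.adjoin_range_blowupChart_eq_top` there) satisfies
  (D) `exists_add_mem_of_mem_blowupChartMonoid`, (K) `exists_map_mul_eq_zero_of_algebraMap_blowupAlgebra_eq_zero`,
  (Ω) `exists_ringHom_blowupAlgebra_comp_eq`;
* chart algebras COMPOSE (`C₂` a chart algebra over `(C, χ)` with `[IsScalarTower A C C₂]` is one over
  `(A, φ)`): (χ) `tower_chi`, (gen) `tower_adjoin_eq_top`, (D) `tower_denominators`, (K) `tower_kernel`,
  (Ω) `tower_fieldExtension` (with `map_chi_ne_zero'`: under (D), maps to fields non-zero on `φ(P)` are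
  non-zero on `χ(Q)`).

So the `N`-th iterated point-blow-up chart over a log regular point is a chart algebra over the ORIGINAL
chart, to which Kato (10.3) (orthant points) and the fixed-point theorems apply with log regularity
needed at that one point only. Honest label: glue toward ONE leaf stub (no stub, crux or summit closed).
No definitions, no named facts, no sorry. [cite: Niziol2006, §4] [cite: GortzWedhorn2020, (13.19) p. 415]
-/

noncomputable section

-- single-problem summit: the doubled namespace component is forced
set_option linter.dupNamespace false

open IsLocalization Literature.AlgebraicGeometry.Resolution Literature.AlgebraicGeometry.Resolution.LogChart

namespace Summit.ResolutionOfSingularities.ResolutionOfSingularities.Theorems.FRationalResolution.ChartAlgebraTower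

universe u

variable {A : Type u} [CommRing A] {n : ℕ} {P : AddSubmonoid (Fin n → ℤ)} {φ : Multiplicative P →* A}

/-! ### The blow-up charts are chart algebras -/

/-- (D) for the blow-up chart monoid: every `q ∈ P_a` has `q + k·a ∈ P` for some `k`, so
`q + p ∈ P` with `p = k·a ∈ P`. [cite: Niziol2006, §4 (proof of Prop. 4.2)] -/
theorem exists_add_mem_of_mem_blowupChartMonoid (s : Set P) (a : P) :
    ∀ q ∈ blowupChartMonoid P s a, ∃ p ∈ P, q + p ∈ P := by
  intro q hq
  obtain ⟨k, hk⟩ := (mem_awayMonoid_iff P).1 (blowupChartMonoid_le_awayMonoid P s a hq)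
  exact ⟨k • (a : Fin n → ℤ), P.nsmul_mem a.2 k, hk⟩

/-- (K) for the affine blowup algebra `A[I/φ(a)] ⊆ A[1/φ(a)]`: an element of `A` vanishing in it is
killed by a power `φ(a)ᵏ = φ(k·a)` of the inverted chart element. [folklore] -/
theorem exists_map_mul_eq_zero_of_algebraMap_blowupAlgebra_eq_zero (I : Ideal A) (a : P) (x : A)
    (hx : algebraMap A (blowupAlgebra I (φ (Multiplicative.ofAdd a))) x = 0) :
    ∃ p : P, φ (Multiplicative.ofAdd p) * x = 0 := by
  have h1 : algebraMap A (Localization.Away (φ (Multiplicative.ofAdd a))) x = 0 := by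
    have := congrArg Subtype.val hx
    simpa using this
  obtain ⟨⟨m, hm⟩, hmx⟩ := (IsLocalization.map_eq_zero_iff
    (Submonoid.powers (φ (Multiplicative.ofAdd a))) (Localization.Away (φ (Multiplicative.ofAdd a))) x).1 h1
  obtain ⟨k, rfl⟩ := (Submonoid.mem_powers_iff _ _).1 hm
  refine ⟨k • a, ?_⟩
  rw [ofAdd_nsmul, map_pow]
  exact hmx

/-- (Ω) for the affine blowup algebra: a ring map `g : A → L` to a field with `g(φ(P)) ∌ 0` extends
to `A[I/φ(a)]` (through `A[1/φ(a)]`, `g(φ(a))` being a unit). [folklore] -/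
theorem exists_ringHom_blowupAlgebra_comp_eq (I : Ideal A) (a : P) (L : Type u) [Field L]
    (g : A →+* L) (hg : ∀ p : P, g (φ (Multiplicative.ofAdd p)) ≠ 0) :
    ∃ ω : blowupAlgebra I (φ (Multiplicative.ofAdd a)) →+* L,
      ω.comp (algebraMap A (blowupAlgebra I (φ (Multiplicative.ofAdd a)))) = g := by
  have hu : IsUnit (g (φ (Multiplicative.ofAdd a))) := (hg a).isUnit
  refine ⟨(IsLocalization.Away.lift (φ (Multiplicative.ofAdd a)) hu).comp
    (blowupAlgebra I (φ (Multiplicative.ofAdd a))).val.toRingHom, ?_⟩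
  ext y
  change IsLocalization.Away.lift (φ (Multiplicative.ofAdd a)) hu
    (algebraMap A (Localization.Away (φ (Multiplicative.ofAdd a))) y) = g y
  rw [IsLocalization.Away.lift_eq]

/-! ### Chart algebras compose -/

variable {C : Type u} [CommRing C] [Algebra A C] {Q : AddSubmonoid (Fin n → ℤ)} {χ : Multiplicative Q →* C}
  {C₂ : Type u} [CommRing C₂] [Algebra C C₂] [Algebra A C₂] [IsScalarTower A C C₂]
  {Q₂ : AddSubmonoid (Fin n → ℤ)} {χ₂ : Multiplicative Q₂ →* C₂}

/-- (χ) composes: if `χ` extends `φ` and `χ₂` extends `χ` then `χ₂` extends `φ`. [folklore] -/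
theorem tower_chi (hPQ : P ≤ Q)
    (hχ : ∀ p : P, χ (Multiplicative.ofAdd ⟨(p : Fin n → ℤ), hPQ p.2⟩) =
      algebraMap A C (φ (Multiplicative.ofAdd p)))
    (hQQ₂ : Q ≤ Q₂)
    (hχ₂ : ∀ q : Q, χ₂ (Multiplicative.ofAdd ⟨(q : Fin n → ℤ), hQQ₂ q.2⟩) =
      algebraMap C C₂ (χ (Multiplicative.ofAdd q))) :
    ∀ p : P, χ₂ (Multiplicative.ofAdd ⟨(p : Fin n → ℤ), (hPQ.trans hQQ₂) p.2⟩) =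
      algebraMap A C₂ (φ (Multiplicative.ofAdd p)) := by
  intro p
  rw [IsScalarTower.algebraMap_apply A C C₂, ← hχ p]
  exact hχ₂ ⟨(p : Fin n → ℤ), hPQ p.2⟩

/-- (gen) composes: `C = A[χ(Q)]`, `C₂ = C[χ₂(Q₂)]`, `χ₂ ⊇ χ` ⇒ `C₂ = A[χ₂(Q₂)]`. [folklore] -/
theorem tower_adjoin_eq_top (hgen : Algebra.adjoin A (Set.range χ) = ⊤) (hQQ₂ : Q ≤ Q₂)
    (hχ₂ : ∀ q : Q, χ₂ (Multiplicative.ofAdd ⟨(q : Fin n → ℤ), hQQ₂ q.2⟩) =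
      algebraMap C C₂ (χ (Multiplicative.ofAdd q)))
    (hgen₂ : Algebra.adjoin C (Set.range χ₂) = ⊤) :
    Algebra.adjoin A (Set.range χ₂) = ⊤ := by
  -- the image of `C` lies in `adjoin A (range χ₂)`
  have hC : ∀ c : C, algebraMap C C₂ c ∈ Algebra.adjoin A (Set.range χ₂) := by
    intro c
    have hc : c ∈ Algebra.adjoin A (Set.range χ) := by rw [hgen]; exact Algebra.mem_top
    have h1 : (Algebra.adjoin A (Set.range χ)).map (IsScalarTower.toAlgHom A C C₂) ≤
        Algebra.adjoin A (Set.range χ₂) := by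
      rw [AlgHom.map_adjoin]
      refine Algebra.adjoin_mono ?_
      rintro _ ⟨_, ⟨q, rfl⟩, rfl⟩
      refine ⟨Multiplicative.ofAdd ⟨((Multiplicative.toAdd q : Q) : Fin n → ℤ),
        hQQ₂ (Multiplicative.toAdd q).2⟩, ?_⟩
      rw [IsScalarTower.coe_toAlgHom']
      exact hχ₂ (Multiplicative.toAdd q)
    exact h1 ⟨c, hc, rfl⟩
  -- hence `adjoin C (range χ₂) ≤ adjoin A (range χ₂)` as sets
  rw [eq_top_iff]
  rintro z -
  have hz : z ∈ Algebra.adjoin C (Set.range χ₂) := by rw [hgen₂]; exact Algebra.mem_top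
  induction hz using Algebra.adjoin_induction with
  | mem x hx => exact Algebra.subset_adjoin hx
  | algebraMap c => exact hC c
  | add x y _ _ hx hy => exact Subalgebra.add_mem _ hx hy
  | mul x y _ _ hx hy => exact Subalgebra.mul_mem _ hx hy

/-- (D) composes. [folklore] -/
theorem tower_denominators (hPQ : P ≤ Q) (hD : ∀ q ∈ Q, ∃ p ∈ P, q + p ∈ P)
    (hD₂ : ∀ q₂ ∈ Q₂, ∃ q ∈ Q, q₂ + q ∈ Q) :
    ∀ q₂ ∈ Q₂, ∃ p ∈ P, q₂ + p ∈ P := by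
  intro q₂ hq₂
  obtain ⟨q, hq, hq₂q⟩ := hD₂ q₂ hq₂
  obtain ⟨p₁, hp₁, hqp₁⟩ := hD q hq
  obtain ⟨p₂, hp₂, h⟩ := hD (q₂ + q + p₁) (Q.add_mem hq₂q (hPQ hp₁))
  refine ⟨q + p₁ + p₂, P.add_mem hqp₁ hp₂, ?_⟩
  have : q₂ + (q + p₁ + p₂) = q₂ + q + p₁ + p₂ := by abel
  rw [this]; exact h

/-- (K) composes. [folklore] -/
theorem tower_kernel (hPQ : P ≤ Q)
    (hχ : ∀ p : P, χ (Multiplicative.ofAdd ⟨(p : Fin n → ℤ), hPQ p.2⟩) =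
      algebraMap A C (φ (Multiplicative.ofAdd p)))
    (hD : ∀ q ∈ Q, ∃ p ∈ P, q + p ∈ P)
    (hK : ∀ a : A, algebraMap A C a = 0 → ∃ p : P, φ (Multiplicative.ofAdd p) * a = 0)
    (hK₂ : ∀ c : C, algebraMap C C₂ c = 0 → ∃ q : Q, χ (Multiplicative.ofAdd q) * c = 0) :
    ∀ a : A, algebraMap A C₂ a = 0 → ∃ p : P, φ (Multiplicative.ofAdd p) * a = 0 := by
  intro a ha
  rw [IsScalarTower.algebraMap_apply A C C₂] at ha
  obtain ⟨q, hq⟩ := hK₂ _ ha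
  obtain ⟨p₁, hp₁, hqp₁⟩ := hD _ q.2
  -- `χ(q + p₁) a = φ(q + p₁) a ↦ 0` in `C`
  have h1 : algebraMap A C (φ (Multiplicative.ofAdd ⟨(q : Fin n → ℤ) + p₁, hqp₁⟩) * a) = 0 := by
    rw [map_mul, ← hχ ⟨(q : Fin n → ℤ) + p₁, hqp₁⟩]
    have h2 : χ (Multiplicative.ofAdd (⟨(q : Fin n → ℤ) + p₁, hPQ hqp₁⟩ : Q)) =
        χ (Multiplicative.ofAdd ⟨p₁, hPQ hp₁⟩) * χ (Multiplicative.ofAdd q) := by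
      rw [← map_mul, ← ofAdd_add]
      congr 1
      apply Multiplicative.toAdd.injective
      apply Subtype.ext
      change (q : Fin n → ℤ) + p₁ = p₁ + q
      abel
    rw [h2, mul_assoc, hq, mul_zero]
  obtain ⟨p, hp⟩ := hK _ h1
  refine ⟨p + ⟨(q : Fin n → ℤ) + p₁, hqp₁⟩, ?_⟩
  rw [ofAdd_add, map_mul, mul_assoc]
  exact hp

omit [Algebra A C₂] [IsScalarTower A C C₂] in
/-- Under (D), a ring map non-zero on `φ(P)` is non-zero on `χ(Q)`: `χ(q)·χ(p) = φ(q + p)`.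
[folklore] -/
theorem map_chi_ne_zero' (hPQ : P ≤ Q)
    (hχ : ∀ p : P, χ (Multiplicative.ofAdd ⟨(p : Fin n → ℤ), hPQ p.2⟩) =
      algebraMap A C (φ (Multiplicative.ofAdd p)))
    (hD : ∀ q ∈ Q, ∃ p ∈ P, q + p ∈ P) {L : Type u} [Field L] {g₀ : A →+* L}
    (hg₀ : ∀ p : P, g₀ (φ (Multiplicative.ofAdd p)) ≠ 0) {ω : C →+* L}
    (hω : ω.comp (algebraMap A C) = g₀) (q : Q) : ω (χ (Multiplicative.ofAdd q)) ≠ 0 := by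
  obtain ⟨p, hp, hqp⟩ := hD _ q.2
  intro h0
  apply hg₀ ⟨(q : Fin n → ℤ) + p, hqp⟩
  have h1 : χ (Multiplicative.ofAdd (⟨(q : Fin n → ℤ) + p, hPQ hqp⟩ : Q)) =
      χ (Multiplicative.ofAdd q) * χ (Multiplicative.ofAdd ⟨p, hPQ hp⟩) := by
    rw [← map_mul, ← ofAdd_add]; rfl
  rw [← hω, RingHom.comp_apply, ← hχ ⟨(q : Fin n → ℤ) + p, hqp⟩, h1, map_mul, h0, zero_mul]

/-- (Ω) composes (given (D) for the lower storey). [folklore] -/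
theorem tower_fieldExtension (hPQ : P ≤ Q)
    (hχ : ∀ p : P, χ (Multiplicative.ofAdd ⟨(p : Fin n → ℤ), hPQ p.2⟩) =
      algebraMap A C (φ (Multiplicative.ofAdd p)))
    (hD : ∀ q ∈ Q, ∃ p ∈ P, q + p ∈ P)
    (hΩ : ∀ (L : Type u) [Field L] (g : A →+* L), (∀ p : P, g (φ (Multiplicative.ofAdd p)) ≠ 0) →
      ∃ ω : C →+* L, ω.comp (algebraMap A C) = g)
    (hΩ₂ : ∀ (L : Type u) [Field L] (g : C →+* L), (∀ q : Q, g (χ (Multiplicative.ofAdd q)) ≠ 0) →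
      ∃ ω : C₂ →+* L, ω.comp (algebraMap C C₂) = g) :
    ∀ (L : Type u) [Field L] (g : A →+* L), (∀ p : P, g (φ (Multiplicative.ofAdd p)) ≠ 0) →
      ∃ ω : C₂ →+* L, ω.comp (algebraMap A C₂) = g := by
  intro L _ g hg
  obtain ⟨ω, hω⟩ := hΩ L g hg
  obtain ⟨ω₂, hω₂⟩ := hΩ₂ L ω (map_chi_ne_zero' hPQ hχ hD hg hω)
  refine ⟨ω₂, ?_⟩
  rw [IsScalarTower.algebraMap_eq A C C₂, ← RingHom.comp_assoc, hω₂, hω]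

end Summit.ResolutionOfSingularities.ResolutionOfSingularities.Theorems.FRationalResolution.ChartAlgebraTower

end
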